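import Literature.Topology.FourManifolds.PlumbingFunction
import Literature.Topology.FourManifolds.PlumbingChart
import HarnessLib

/-!
# The deformation of the plumbing `M(4m)` onto its core spheres

Topic `Literature/Topology/FourManifolds`; part of the proof that Kosinski's plumbing `M(4m)` is
stably parallelisable (A. Kosinski, *Differential Manifolds* (1993), VI.12: "the plumbing has the
homotopy type of the union of the core spheres"; IX.(7.5)). We construct an explicit homotopy
`Θₜ` of the plumbed manifold, `Θ₀ = id`, such that `Θ₁` maps `M(4m) = {ρ ≤ r²/8}` into the union of
the cores:

* `Plumbing.fshrink τ (p, q) = (p, (1 - τ) (q - ⟪q, p⟫ p) + √(…) p)` — **the fibre shrink**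
  (geodesic retraction of the fibre disc onto its centre, linear in the polar coordinate:
  `kapSnd_fshrink`);
* `Plumbing.amt x ∈ [0, 1]` — the amount of shrinking, a function of the squared fibre radius `b`,
  `= 1` for `b ≤ 3r²/4`, `= 0` for `b ≥ 7r²/8`; `Plumbing.Fmap t = fshrink (t · amt)`;
* `Plumbing.Bmap j t = pm_j ∘ Fmap t ∘ pm_j` on the plumbing domain `D_j`, the identity off it
  (**the base shrink**, continuous because `Fmap t = id` near the outer boundary of the tube);
* `Plumbing.Phi t = Fmap t ∘ Bmap 0 t ∘ Bmap 1 t ∘ Bmap 2 t` — in the polar chart of `D_j` it is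
  `(x, y) ↦ (g x, g y)` (`kap_Phi`), hence **compatible with the plumbing maps** (`pm_Phi`), and it
  descends to `Plumbing.Theta t : P → P` on the plumbed manifold (`Plumbing.desc`);
* `Theta_zero`, `continuous_Theta` (jointly in `(t, p)`), and `Theta_one_mem_coreUnion'`: for
  `ρ(p) ≤ r²/8`, `Θ₁(p)` lies on a core sphere.

Everything is proved; no named facts (D-0026).

## References

* A. Kosinski, *Differential Manifolds*, Academic Press 1993, VI.12, IX.(7.5). [Kosinski1993]
-/

open scoped Manifold ContDiff Topology RealInnerProductSpace unitInterval
open Set Function Module Filter Metric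

noncomputable section

namespace Literature.Topology.FourManifolds

namespace Plumbing

/-- Local notation: `𝔼 n` is the model Euclidean space `EuclideanSpace ℝ (Fin n)`. -/
local notation "𝔼 " n:arg => EuclideanSpace ℝ (Fin n)

/-- Local notation: `𝕊 n` is the unit sphere in `EuclideanSpace ℝ (Fin (n + 1))`. -/
local notation "𝕊 " n:arg => (Metric.sphere (0 : EuclideanSpace ℝ (Fin (n + 1))) 1)

variable {k : ℕ} {c : ℝ}

/-! ### §1 Linear algebra of `rotTo`, `rotFrom`, `perp` -/

section Lin

variable {E : Type*} [NormedAddCommGroup E] [InnerProductSpace ℝ E]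

/-- `rotTo_add` (rotTo add). [folklore] -/
theorem rotTo_add (p e x y : E) : rotTo p e (x + y) = rotTo p e x + rotTo p e y := by
  rw [rotTo, rotTo, rotTo, refl_add, refl_add]

/-- `rotTo_smul` (rotTo smul). [folklore] -/
theorem rotTo_smul (p e : E) (a : ℝ) (x : E) : rotTo p e (a • x) = a • rotTo p e x := by
  rw [rotTo, rotTo, refl_smul_right, refl_smul_right]

/-- `rotTo_sub` (rotTo sub). [folklore] -/
theorem rotTo_sub (p e x y : E) : rotTo p e (x - y) = rotTo p e x - rotTo p e y := by
  rw [sub_eq_add_neg, rotTo_add, ← neg_one_smul ℝ y, rotTo_smul, neg_one_smul, ← sub_eq_add_neg]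

/-- `rotFrom_smul` (rotFrom smul). [folklore] -/
theorem rotFrom_smul (p e : E) (a : ℝ) (x : E) : rotFrom p e (a • x) = a • rotFrom p e x := by
  rw [rotFrom, rotFrom, refl_smul_right, refl_smul_right]

/-- `perp_add` (perp add). [folklore] -/
theorem perp_add (e x y : E) : perp e (x + y) = perp e x + perp e y := by
  simp only [perp, inner_add_left, add_smul]; abel

/-- `perp_smul` (perp smul). [folklore] -/
theorem perp_smul (e : E) (a : ℝ) (x : E) : perp e (a • x) = a • perp e x := by
  simp only [perp, real_inner_smul_left, smul_sub, smul_smul]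

/-- `perp_self` (perp self). [folklore] -/
theorem perp_self {e : E} (he : ‖e‖ = 1) : perp e e = 0 := by
  rw [perp, real_inner_self_eq_norm_sq, he, one_pow, one_smul, sub_self]

/-- `perp_sub` (perp sub). [folklore] -/
theorem perp_sub (e x y : E) : perp e (x - y) = perp e x - perp e y := by
  simp only [perp, inner_sub_left, sub_smul]; abel

end Lin

/-! ### §2 The fibre shrink -/

section Shrink

/-- The shrunk fibre vector `(1 - τ) (q - ⟪q, p⟫ p) + √(1 - ‖…‖²) p`. [folklore] -/
def fsVec (τ : ℝ) (pq : (𝕊 k) × (𝕊 k)) : 𝔼 (k + 1) :=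
  capLift (pq.1 : 𝔼 (k + 1)) ((1 - τ) • perp (pq.1 : 𝔼 (k + 1)) (pq.2 : 𝔼 (k + 1)))

/-- `inner_perp_base` (inner perp base). [folklore] -/
theorem inner_perp_base (pq : (𝕊 k) × (𝕊 k)) :
    ⟪perp (pq.1 : 𝔼 (k + 1)) (pq.2 : 𝔼 (k + 1)), (pq.1 : 𝔼 (k + 1))⟫ = 0 :=
  inner_perp_left (norm_eq_of_mem_sphere pq.1) _

/-- `‖q - ⟪q, p⟫ p‖² = b(p, q)`. [folklore] -/
theorem norm_perp_base_sq (pq : (𝕊 k) × (𝕊 k)) :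
    ‖perp (pq.1 : 𝔼 (k + 1)) (pq.2 : 𝔼 (k + 1))‖ ^ 2 = bFn pq := by
  rw [norm_perp_sq (norm_eq_of_mem_sphere pq.1), norm_eq_of_mem_sphere pq.2, one_pow, bFn_apply, fibHt_apply,
    real_inner_comm]

/-- `norm_smul_perp_sq` (norm smul perp sq). [folklore] -/
theorem norm_smul_perp_sq (τ : ℝ) (pq : (𝕊 k) × (𝕊 k)) :
    ‖(1 - τ) • perp (pq.1 : 𝔼 (k + 1)) (pq.2 : 𝔼 (k + 1))‖ ^ 2 = (1 - τ) ^ 2 * bFn pq := by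
  rw [norm_smul, mul_pow, Real.norm_eq_abs, sq_abs, norm_perp_base_sq]

/-- The shrunk fibre vector is a unit vector (`0 ≤ τ ≤ 1`). [folklore] -/
theorem norm_fsVec {τ : ℝ} (hτ : τ ∈ Icc (0 : ℝ) 1) (pq : (𝕊 k) × (𝕊 k)) : ‖fsVec τ pq‖ = 1 := by
  refine norm_capLift (norm_eq_of_mem_sphere pq.1) ?_ ?_
  · rw [real_inner_smul_left, inner_perp_base, mul_zero]
  · have h : ‖(1 - τ) • perp (pq.1 : 𝔼 (k + 1)) (pq.2 : 𝔼 (k + 1))‖ ^ 2 ≤ 1 := by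
      rw [norm_smul_perp_sq]
      have hb := bFn_le_one pq
      have hb0 := bFn_nonneg pq
      have h1 : (1 - τ) ^ 2 ≤ 1 := by nlinarith [hτ.1, hτ.2]
      nlinarith
    nlinarith [norm_nonneg ((1 - τ) • perp (pq.1 : 𝔼 (k + 1)) (pq.2 : 𝔼 (k + 1)))]

/-- The height of the shrunk fibre vector: `⟪p, q'⟫ = √(1 - (1 - τ)² b)`. [folklore] -/
theorem inner_fsVec (τ : ℝ) (pq : (𝕊 k) × (𝕊 k)) :
    ⟪(pq.1 : 𝔼 (k + 1)), fsVec τ pq⟫ = Real.sqrt (1 - (1 - τ) ^ 2 * bFn pq) := by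
  rw [real_inner_comm, fsVec, inner_capLift (norm_eq_of_mem_sphere pq.1)
    (by rw [real_inner_smul_left, inner_perp_base, mul_zero]), norm_smul_perp_sq]

/-- The fibre height only grows under the shrink (`0 ≤ τ ≤ 1`, `⟪p, q⟫ ≥ 0`). [folklore] -/
theorem fibHt_le_inner_fsVec {τ : ℝ} (hτ : τ ∈ Icc (0 : ℝ) 1) {pq : (𝕊 k) × (𝕊 k)} (h0 : 0 ≤ fibHt pq) :
    fibHt pq ≤ ⟪(pq.1 : 𝔼 (k + 1)), fsVec τ pq⟫ := by
  rw [inner_fsVec]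
  have hb := bFn_le_one pq
  have hb0 := bFn_nonneg pq
  have h1 : (1 - τ) ^ 2 ≤ 1 := by nlinarith [hτ.1, hτ.2]
  have hf : fibHt pq = Real.sqrt (1 - bFn pq) := by
    rw [bFn_apply, show 1 - (1 - fibHt pq ^ 2) = fibHt pq ^ 2 by ring, Real.sqrt_sq h0]
  rw [hf]
  exact Real.sqrt_le_sqrt (by nlinarith)

/-- **The fibre shrink** of the tube, `(p, q) ↦ (p, q_τ)`. [folklore] -/
def fshrink (τ : I) (x : Tb k c) : Tb k c :=
  ⟨((x : (𝕊 k) × (𝕊 k)).1, ⟨fsVec τ (x : (𝕊 k) × (𝕊 k)), by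
      rw [mem_sphere_zero_iff_norm]; exact norm_fsVec ⟨τ.2.1, τ.2.2⟩ (x : (𝕊 k) × (𝕊 k))⟩), by
    change c < ⟪((x : (𝕊 k) × (𝕊 k)).1 : 𝔼 (k + 1)), fsVec τ (x : (𝕊 k) × (𝕊 k))⟫
    have hx := lt_fibHt_coe x
    by_cases h0 : 0 ≤ fibHt (x : (𝕊 k) × (𝕊 k))
    · exact hx.trans_le (fibHt_le_inner_fsVec ⟨τ.2.1, τ.2.2⟩ h0)
    · push Not at h0
      have : c < 0 := hx.trans h0
      refine this.trans_le ?_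
      rw [inner_fsVec]; exact Real.sqrt_nonneg _⟩

/-- `coe_fshrink_fst` (coe fshrink fst). [folklore] -/
@[simp] theorem coe_fshrink_fst (τ : I) (x : Tb k c) : ((fshrink τ x : Tb k c) : (𝕊 k) × (𝕊 k)).1 = (x : (𝕊 k) × (𝕊 k)).1 := rfl

/-- `coe_fshrink_snd` (coe fshrink snd). [folklore] -/
theorem coe_fshrink_snd (τ : I) (x : Tb k c) :
    (((fshrink τ x : Tb k c) : (𝕊 k) × (𝕊 k)).2 : 𝔼 (k + 1)) = fsVec τ (x : (𝕊 k) × (𝕊 k)) := rfl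

/-- `baseHt_fshrink` (baseHt fshrink). [folklore] -/
@[simp] theorem baseHt_fshrink (e : 𝕊 k) (τ : I) (x : Tb k c) :
    baseHt e (fshrink τ x : (𝕊 k) × (𝕊 k)) = baseHt e (x : (𝕊 k) × (𝕊 k)) := rfl

/-- `aFn_fshrink` (aFn fshrink). [folklore] -/
@[simp] theorem aFn_fshrink (e : 𝕊 k) (τ : I) (x : Tb k c) : aFn e (fshrink τ x : (𝕊 k) × (𝕊 k)) = aFn e (x : (𝕊 k) × (𝕊 k)) := rfl

/-- `fibHt_fshrink` (fibHt fshrink). [folklore] -/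
theorem fibHt_fshrink (τ : I) (x : Tb k c) :
    fibHt (fshrink τ x : (𝕊 k) × (𝕊 k)) = Real.sqrt (1 - (1 - (τ : ℝ)) ^ 2 * bFn (x : (𝕊 k) × (𝕊 k))) :=
  inner_fsVec τ (x : (𝕊 k) × (𝕊 k))

/-- **The squared fibre radius scales by `(1 - τ)²`.** [folklore] -/
theorem bFn_fshrink (τ : I) (x : Tb k c) : bFn (fshrink τ x : (𝕊 k) × (𝕊 k)) = (1 - (τ : ℝ)) ^ 2 * bFn (x : (𝕊 k) × (𝕊 k)) := by
  rw [bFn_apply, fibHt_fshrink, Real.sq_sqrt]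
  · ring
  · have hb := bFn_le_one (x : (𝕊 k) × (𝕊 k))
    have hb0 := bFn_nonneg (x : (𝕊 k) × (𝕊 k))
    have h1 : (1 - (τ : ℝ)) ^ 2 ≤ 1 := by nlinarith [τ.2.1, τ.2.2]
    nlinarith

/-- **`fshrink 0 = id`** (`⟪q, p⟫ ≥ 0` on the tube). [folklore] -/
theorem fshrink_zero (hc : 0 ≤ c) (x : Tb k c) : fshrink 0 x = x := by
  apply Subtype.ext
  refine Prod.ext rfl (Subtype.ext ?_)
  rw [coe_fshrink_snd, fsVec]
  simp only [Set.Icc.coe_zero, sub_zero, one_smul]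
  refine capLift_perp (norm_eq_of_mem_sphere _) (norm_eq_of_mem_sphere _) ?_
  rw [real_inner_comm, ← fibHt_apply]; exact hc.trans (lt_fibHt_coe x).le

/-- **`fshrink 1` lands on the diagonal.** [folklore] -/
theorem coe_fshrink_one (x : Tb k c) : (fshrink 1 x : (𝕊 k) × (𝕊 k)) = ((x : (𝕊 k) × (𝕊 k)).1, (x : (𝕊 k) × (𝕊 k)).1) := by
  refine Prod.ext rfl (Subtype.ext ?_)
  rw [coe_fshrink_snd, fsVec]
  simp [capLift]

/-- Continuity of the shrunk fibre vector in `(τ, (p, q))`. [folklore] -/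
theorem continuous_fsVec : Continuous fun p : ℝ × ((𝕊 k) × (𝕊 k)) => fsVec p.1 p.2 := by
  unfold fsVec capLift perp
  fun_prop

/-- **Continuity of the fibre shrink** in `(τ, x)`. [folklore] -/
theorem continuous_fshrink : Continuous fun p : I × Tb k c => fshrink p.1 p.2 := by
  refine Continuous.subtype_mk (Continuous.prodMk ?_ (Continuous.subtype_mk ?_ _)) _
  · exact continuous_fst.comp (continuous_subtype_val.comp continuous_snd)
  · exact continuous_fsVec.comp ((continuous_subtype_val.comp continuous_fst).prodMk
      (continuous_subtype_val.comp continuous_snd))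

/-- **The fibre shrink in the polar chart is `y ↦ (1 - τ) y`.** [folklore] -/
theorem kapSnd_fshrink (e : 𝕊 k) (τ : I) {x : Tb k c} (h : -1 < baseHt e (x : (𝕊 k) × (𝕊 k))) :
    kapSnd e (fshrink τ x : (𝕊 k) × (𝕊 k)) = (1 - (τ : ℝ)) • kapSnd e (x : (𝕊 k) × (𝕊 k)) := by
  obtain ⟨⟨p, q⟩, hx⟩ := x
  have he := norm_eq_of_mem_sphere e
  have hpe : ‖(p : 𝔼 (k + 1))‖ = ‖(e : 𝔼 (k + 1))‖ := by rw [norm_eq_of_mem_sphere, he]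
  have h0 : (p : 𝔼 (k + 1)) + (e : 𝔼 (k + 1)) ≠ 0 := add_ne_zero_of_neg_one_lt_inner he (by rwa [baseHt_apply] at h)
  have h1 : rotTo (p : 𝔼 (k + 1)) e (perp (p : 𝔼 (k + 1)) (q : 𝔼 (k + 1))) =
      rotTo (p : 𝔼 (k + 1)) e q - ⟪(q : 𝔼 (k + 1)), (p : 𝔼 (k + 1))⟫ • (e : 𝔼 (k + 1)) := by
    rw [perp, rotTo_sub, rotTo_smul, rotTo_self hpe h0]
  have h2 : perp (e : 𝔼 (k + 1)) (rotTo (p : 𝔼 (k + 1)) e (perp (p : 𝔼 (k + 1)) (q : 𝔼 (k + 1)))) =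
      perp (e : 𝔼 (k + 1)) (rotTo (p : 𝔼 (k + 1)) e q) := by
    rw [h1, perp_sub, perp_smul, perp_self he, smul_zero, sub_zero]
  change perp (e : 𝔼 (k + 1)) (rotTo (p : 𝔼 (k + 1)) e (fsVec τ (p, q))) =
    (1 - (τ : ℝ)) • perp (e : 𝔼 (k + 1)) (rotTo (p : 𝔼 (k + 1)) e q)
  rw [fsVec, capLift, rotTo_add, rotTo_smul, rotTo_smul]
  change perp (e : 𝔼 (k + 1)) ((1 - (τ : ℝ)) • rotTo (p : 𝔼 (k + 1)) e (perp (p : 𝔼 (k + 1)) (q : 𝔼 (k + 1))) +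
      Real.sqrt (1 - ‖(1 - (τ : ℝ)) • perp (p : 𝔼 (k + 1)) (q : 𝔼 (k + 1))‖ ^ 2) • rotTo (p : 𝔼 (k + 1)) e p) = _
  rw [rotTo_self hpe h0, perp_add, perp_smul, perp_smul, perp_self he, smul_zero, add_zero, h2]

/-- `kapFst_fshrink` (kapFst fshrink). [folklore] -/
@[simp] theorem kapFst_fshrink (e : 𝕊 k) (τ : I) (x : Tb k c) :
    kapFst e (fshrink τ x : (𝕊 k) × (𝕊 k)) = kapFst e (x : (𝕊 k) × (𝕊 k)) := rfl

end Shrink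

/-! ### §3 The amount function and the damped fibre shrink `Fmap` -/

section Fmap

/-- The **piecewise-linear clamp** `u ↦ max 0 (min u 1)` onto `[0, 1]` (the function underlying
Mathlib's `Set.projIcc 0 1`, kept real-valued). Not to be confused with the *smooth* clamp
`Literature.Topology.FourManifolds.clamp01 := Real.smoothTransition` of `BandSumWindowFamily`;
here only continuity is needed. [folklore] -/
def linClamp01 (u : ℝ) : ℝ := max 0 (min u 1)

/-- `linClamp01_mem` (linClamp01 mem). [folklore] -/
theorem linClamp01_mem (u : ℝ) : linClamp01 u ∈ Icc (0 : ℝ) 1 :=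
  ⟨le_max_left _ _, max_le zero_le_one (min_le_right _ _)⟩

/-- `linClamp01_of_le_zero` (linClamp01 of le zero). [folklore] -/
theorem linClamp01_of_le_zero {u : ℝ} (h : u ≤ 0) : linClamp01 u = 0 := by
  rw [linClamp01, max_eq_left]; exact (min_le_left _ _).trans h

/-- `linClamp01_of_one_le` (linClamp01 of one le). [folklore] -/
theorem linClamp01_of_one_le {u : ℝ} (h : 1 ≤ u) : linClamp01 u = 1 := by
  rw [linClamp01, min_eq_right h, max_eq_right zero_le_one]

/-- `continuous_linClamp01` (continuous linClamp01). [folklore] -/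
theorem continuous_linClamp01 : Continuous linClamp01 := by unfold linClamp01; fun_prop

variable (c) in
/-- The amount as a function of the squared fibre radius `b`: `λ(8 (r² - b)/r² - 1)`. [folklore] -/
def amtOf (b : ℝ) : ℝ := linClamp01 (8 * (rsq c - b) / rsq c - 1)

/-- `continuous_amtOf` (continuous amtOf). [folklore] -/
theorem continuous_amtOf : Continuous (amtOf c) := by unfold amtOf; exact continuous_linClamp01.comp (by fun_prop)

/-- `amtOf_mem` (amtOf mem). [folklore] -/
theorem amtOf_mem (b : ℝ) : amtOf c b ∈ Icc (0 : ℝ) 1 := linClamp01_mem _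

/-- The amount vanishes near the outer boundary of the tube (`b ≥ 7r²/8`). [folklore] -/
theorem amtOf_eq_zero (hc : IsParam c) {b : ℝ} (hb : 7 * rsq c / 8 ≤ b) : amtOf c b = 0 := by
  apply linClamp01_of_le_zero
  have hR := rsq_pos hc
  rw [sub_nonpos, div_le_one hR]; linarith

/-- The amount is full where `b ≤ 3r²/4`. [folklore] -/
theorem amtOf_eq_one (hc : IsParam c) {b : ℝ} (hb : b ≤ 3 * rsq c / 4) : amtOf c b = 1 := by
  apply linClamp01_of_one_le
  have hR := rsq_pos hc
  rw [le_sub_iff_add_le, le_div_iff₀ hR]; linarith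

variable (c) in
/-- The damped time `t · λ(b(x))` as a point of `[0, 1]`. [folklore] -/
def tI (t : I) (x : Tb k c) : I :=
  ⟨(t : ℝ) * amtOf c (bFn (x : (𝕊 k) × (𝕊 k))),
    ⟨mul_nonneg t.2.1 (amtOf_mem _).1, mul_le_one₀ t.2.2 (amtOf_mem _).1 (amtOf_mem _).2⟩⟩

/-- `continuous_tI` (continuous tI). [folklore] -/
theorem continuous_tI : Continuous fun p : I × Tb k c => tI c p.1 p.2 := by
  refine Continuous.subtype_mk ?_ _
  exact (continuous_subtype_val.comp continuous_fst).mul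
    (continuous_amtOf.comp (continuous_bFn.comp (continuous_subtype_val.comp continuous_snd)))

/-- **The damped fibre shrink** `F_t = fshrink (t λ(b))`. [folklore] -/
def Fmap (t : I) (x : Tb k c) : Tb k c := fshrink (tI c t x) x

/-- `continuous_Fmap` (continuous Fmap). [folklore] -/
theorem continuous_Fmap : Continuous fun p : I × Tb k c => Fmap p.1 p.2 :=
  continuous_fshrink.comp (continuous_tI.prodMk continuous_snd)

/-- `Fmap_zero` (Fmap zero). [folklore] -/
theorem Fmap_zero (hc : IsParam c) (x : Tb k c) : Fmap 0 x = x := by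
  rw [Fmap]
  have : tI c 0 x = 0 := Subtype.ext (by simp [tI])
  rw [this]; exact fshrink_zero hc.nonneg x

/-- `F_t = id` near the outer boundary of the tube. [folklore] -/
theorem Fmap_eq_self (hc : IsParam c) (t : I) {x : Tb k c} (hb : 7 * rsq c / 8 ≤ bFn (x : (𝕊 k) × (𝕊 k))) :
    Fmap t x = x := by
  rw [Fmap]
  have : tI c t x = 0 := Subtype.ext (by simp [tI, amtOf_eq_zero hc hb])
  rw [this]; exact fshrink_zero hc.nonneg x

/-- `baseHt_Fmap` (baseHt Fmap). [folklore] -/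
@[simp] theorem baseHt_Fmap (e : 𝕊 k) (t : I) (x : Tb k c) : baseHt e (Fmap t x : (𝕊 k) × (𝕊 k)) = baseHt e (x : (𝕊 k) × (𝕊 k)) := rfl

/-- `aFn_Fmap` (aFn Fmap). [folklore] -/
@[simp] theorem aFn_Fmap (e : 𝕊 k) (t : I) (x : Tb k c) : aFn e (Fmap t x : (𝕊 k) × (𝕊 k)) = aFn e (x : (𝕊 k) × (𝕊 k)) := rfl

/-- `Fmap` preserves each plumbing domain. [folklore] -/
theorem Fmap_mem_dom_iff (t : I) (j : Fin 3) (x : Tb k c) :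
    (Fmap t x : (𝕊 k) × (𝕊 k)) ∈ dom k c j ↔ (x : (𝕊 k) × (𝕊 k)) ∈ dom k c j := by
  rw [mem_dom, mem_dom, baseHt_Fmap]
  exact ⟨fun h => ⟨h.1, lt_fibHt_coe x⟩, fun h => ⟨h.1, lt_fibHt_coe _⟩⟩

variable (c) in
/-- The fibre shrink in the polar coordinate: `g_t(y) = (1 - t λ(‖y‖²)) y`. [folklore] -/
def gPolar (t : I) (y : 𝔼 (k + 1)) : 𝔼 (k + 1) := (1 - (t : ℝ) * amtOf c (‖y‖ ^ 2)) • y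

/-- **`Fmap` in the polar chart**: `kap_e (F_t x) = (x, g_t y)`. [folklore] -/
theorem kap_Fmap (e : 𝕊 k) (t : I) {x : Tb k c} (h : -1 < baseHt e (x : (𝕊 k) × (𝕊 k))) :
    kap e (Fmap t x : (𝕊 k) × (𝕊 k)) = ((kap e (x : (𝕊 k) × (𝕊 k))).1, gPolar c t (kap e (x : (𝕊 k) × (𝕊 k))).2) := by
  refine Prod.ext rfl ?_
  change kapSnd e (fshrink (tI c t x) x : (𝕊 k) × (𝕊 k)) = gPolar c t (kapSnd e (x : (𝕊 k) × (𝕊 k)))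
  rw [kapSnd_fshrink e _ h, gPolar, norm_kapSnd_sq e h, ← bFn_apply]
  rfl

end Fmap

/-! ### §4 The base shrink `Bmap j` -/

section Bmap

variable (hc : IsParam c)

open Classical in
/-- **The base shrink** for the colour `j`: `pm_j ∘ F_t ∘ pm_j` on `D_j`, the identity off it.
[folklore] -/
def Bmap (j : Fin 3) (t : I) (x : Tb k c) : Tb k c :=
  if (x : (𝕊 k) × (𝕊 k)) ∈ dom k c j then pm hc j (Fmap t (pm hc j x)) else x

/-- `Bmap_of_mem` (Bmap of mem). [folklore] -/
theorem Bmap_of_mem {j : Fin 3} (t : I) {x : Tb k c} (hx : (x : (𝕊 k) × (𝕊 k)) ∈ dom k c j) :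
    Bmap hc j t x = pm hc j (Fmap t (pm hc j x)) := by rw [Bmap, if_pos hx]

/-- `Bmap_of_not_mem` (Bmap of not mem). [folklore] -/
theorem Bmap_of_not_mem {j : Fin 3} (t : I) {x : Tb k c} (hx : (x : (𝕊 k) × (𝕊 k)) ∉ dom k c j) :
    Bmap hc j t x = x := by rw [Bmap, if_neg hx]

/-- `Bmap j` preserves `D_j`. [folklore] -/
theorem Bmap_mem_dom {j : Fin 3} (t : I) {x : Tb k c} (hx : (x : (𝕊 k) × (𝕊 k)) ∈ dom k c j) :
    (Bmap hc j t x : (𝕊 k) × (𝕊 k)) ∈ dom k c j := by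
  rw [Bmap_of_mem hc t hx]
  exact pm_mem_dom hc ((Fmap_mem_dom_iff _ _ _).2 (pm_mem_dom hc hx))

/-- `Bmap j` preserves membership in every plumbing domain. [folklore] -/
theorem Bmap_mem_dom_iff (hk : 2 ≤ k) {j j' : Fin 3} (t : I) (x : Tb k c) :
    (Bmap hc j t x : (𝕊 k) × (𝕊 k)) ∈ dom k c j' ↔ (x : (𝕊 k) × (𝕊 k)) ∈ dom k c j' := by
  by_cases hx : (x : (𝕊 k) × (𝕊 k)) ∈ dom k c j
  · by_cases hjj : j = j'
    · subst hjj; exact ⟨fun _ => hx, fun _ => Bmap_mem_dom hc t hx⟩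
    · have h1 : (x : (𝕊 k) × (𝕊 k)) ∉ dom k c j' := fun h => dom_disjoint hk hc hjj hx h
      have h2 : (Bmap hc j t x : (𝕊 k) × (𝕊 k)) ∉ dom k c j' := fun h =>
        dom_disjoint hk hc hjj (Bmap_mem_dom hc t hx) h
      exact ⟨fun h => absurd h h2, fun h => absurd h h1⟩
  · rw [Bmap_of_not_mem hc t hx]

/-- `Bmap_zero` (Bmap zero). [folklore] -/
theorem Bmap_zero (j : Fin 3) (x : Tb k c) : Bmap hc j 0 x = x := by
  by_cases hx : (x : (𝕊 k) × (𝕊 k)) ∈ dom k c j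
  · rw [Bmap_of_mem hc 0 hx, Fmap_zero hc, pm_pm hc hx]
  · rw [Bmap_of_not_mem hc 0 hx]

/-- **`Bmap j t = id` near the boundary of `D_j`**: on `{a_j > 7r²/8} ∩ D_j` the flipped point has
`b ≥ 7r²/8`, where `F_t = id`. [folklore] -/
theorem Bmap_eq_self_of_lt {j : Fin 3} (t : I) {x : Tb k c} (ha : 7 * rsq c / 8 ≤ aFn (pole k j.val) (x : (𝕊 k) × (𝕊 k))) :
    Bmap hc j t x = x := by
  by_cases hx : (x : (𝕊 k) × (𝕊 k)) ∈ dom k c j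
  · rw [Bmap_of_mem hc t hx]
    have hb : 7 * rsq c / 8 ≤ bFn (pm hc j x : (𝕊 k) × (𝕊 k)) := by
      rw [coe_pm_of_mem hc hx, bFn_plumbMap _ (by linarith [hx.1, hc.nonneg]) (by linarith [hx.2, hc.nonneg])]
      exact ha
    rw [Fmap_eq_self hc t hb, pm_pm hc hx]
  · rw [Bmap_of_not_mem hc t hx]

/-- **Continuity of the base shrink** in `(t, x)`. [folklore] -/
theorem continuous_Bmap (j : Fin 3) : Continuous fun p : I × Tb k c => Bmap hc j p.1 p.2 := by
  rw [continuous_iff_continuousAt]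
  rintro ⟨t₀, x₀⟩
  by_cases hx₀ : (x₀ : (𝕊 k) × (𝕊 k)) ∈ dom k c j
  · -- on the open set `I × D_j` the map is `pm ∘ F ∘ pm`
    have hopen : IsOpen {p : I × Tb k c | (p.2 : (𝕊 k) × (𝕊 k)) ∈ dom k c j} :=
      (isOpen_setOf_coe_mem_dom j).preimage continuous_snd
    have hev : ∀ᶠ p : I × Tb k c in 𝓝 (t₀, x₀), (p.2 : (𝕊 k) × (𝕊 k)) ∈ dom k c j := hopen.mem_nhds hx₀
    have hcont : ContinuousAt (fun p : I × Tb k c => pm hc j (Fmap p.1 (pm hc j p.2))) (t₀, x₀) := by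
      have h1 : ContinuousAt (fun p : I × Tb k c => pm hc j p.2) (t₀, x₀) :=
        ContinuousAt.comp (f := fun p : I × Tb k c => p.2) (x := (t₀, x₀)) (continuousAt_pm hc hx₀) continuousAt_snd
      have h2 : ContinuousAt (fun p : I × Tb k c => Fmap p.1 (pm hc j p.2)) (t₀, x₀) :=
        continuous_Fmap.continuousAt.comp (continuousAt_fst.prodMk h1)
      have hmem : (Fmap t₀ (pm hc j x₀) : (𝕊 k) × (𝕊 k)) ∈ dom k c j :=
        (Fmap_mem_dom_iff _ _ _).2 (pm_mem_dom hc hx₀)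
      exact ContinuousAt.comp (f := fun p : I × Tb k c => Fmap p.1 (pm hc j p.2)) (x := (t₀, x₀))
        (continuousAt_pm hc hmem) h2
    refine hcont.congr (hev.mono fun p hp => ?_)
    exact (Bmap_of_mem hc p.1 hp).symm
  · -- off `D_j`: the identity on the open neighbourhood `{baseHt < c} ∪ {a_j > 7r²/8}`
    have hb : baseHt (pole k j.val) (x₀ : (𝕊 k) × (𝕊 k)) ≤ c := by
      by_contra hlt; exact hx₀ ⟨lt_of_not_ge hlt, lt_fibHt_coe x₀⟩
    set U : Set (I × Tb k c) := {p | baseHt (pole k j.val) (p.2 : (𝕊 k) × (𝕊 k)) < c} ∪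
      {p | 7 * rsq c / 8 < aFn (pole k j.val) (p.2 : (𝕊 k) × (𝕊 k))} with hU
    have hUo : IsOpen U :=
      (isOpen_lt ((continuous_baseHt _).comp (continuous_subtype_val.comp continuous_snd)) continuous_const).union
        (isOpen_lt continuous_const ((continuous_aFn _).comp (continuous_subtype_val.comp continuous_snd)))
    have hmemU : (t₀, x₀) ∈ U := by
      rcases hb.lt_or_eq with hlt | heq
      · exact Or.inl hlt
      · right
        change 7 * rsq c / 8 < aFn (pole k j.val) (x₀ : (𝕊 k) × (𝕊 k))
        rw [aFn_eq_rsq _ heq]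
        linarith [rsq_pos hc]
    have hev : ∀ᶠ p : I × Tb k c in 𝓝 (t₀, x₀), Bmap hc j p.1 p.2 = p.2 := by
      filter_upwards [hUo.mem_nhds hmemU] with p hp
      rcases hp with hp | hp
      · exact Bmap_of_not_mem hc p.1 fun h => (not_lt.2 h.1.le) hp
      · exact Bmap_eq_self_of_lt hc p.1 hp.le
    exact (continuousAt_snd.congr (hev.mono fun p hp => hp.symm) : _)

/-- **`Bmap j` in the polar chart of `D_j`**: `kap_e (B_t x) = (g_t x, y)`. [folklore] -/
theorem kap_Bmap {j : Fin 3} (t : I) {x : Tb k c} (hx : (x : (𝕊 k) × (𝕊 k)) ∈ dom k c j) :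
    kap (pole k j.val) (Bmap hc j t x : (𝕊 k) × (𝕊 k)) =
      (gPolar c t (kap (pole k j.val) (x : (𝕊 k) × (𝕊 k))).1, (kap (pole k j.val) (x : (𝕊 k) × (𝕊 k))).2) := by
  have hpm := pm_mem_dom hc hx
  have hF : (Fmap t (pm hc j x) : (𝕊 k) × (𝕊 k)) ∈ dom k c j := (Fmap_mem_dom_iff _ _ _).2 hpm
  rw [Bmap_of_mem hc t hx, coe_pm_of_mem hc hF, kap_plumbMap, kap_Fmap _ t (by linarith [hpm.1, hc.nonneg]),
    coe_pm_of_mem hc hx, kap_plumbMap]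
  rfl

end Bmap

/-! ### §5 The tube map `Phi` and its compatibility with the plumbings -/

section Phi

variable (hk : 2 ≤ k) (hc : IsParam c)

/-- **The tube map** `Φ_t = F_t ∘ B_0 ∘ B_1 ∘ B_2`. [folklore] -/
def Phi (t : I) (x : Tb k c) : Tb k c := Fmap t (Bmap hc 0 t (Bmap hc 1 t (Bmap hc 2 t x)))

/-- `continuous_Phi` (continuous Phi). [folklore] -/
theorem continuous_Phi : Continuous fun p : I × Tb k c => Phi hc p.1 p.2 := by
  unfold Phi
  have h2 := continuous_Bmap (k := k) hc (2 : Fin 3)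
  have h1 : Continuous fun p : I × Tb k c => Bmap hc 1 p.1 (Bmap hc 2 p.1 p.2) :=
    (continuous_Bmap (k := k) hc (1 : Fin 3)).comp (continuous_fst.prodMk h2)
  have h0 : Continuous fun p : I × Tb k c => Bmap hc 0 p.1 (Bmap hc 1 p.1 (Bmap hc 2 p.1 p.2)) :=
    (continuous_Bmap (k := k) hc (0 : Fin 3)).comp (continuous_fst.prodMk h1)
  exact continuous_Fmap.comp (continuous_fst.prodMk h0)

/-- `Phi_zero` (Phi zero). [folklore] -/
theorem Phi_zero (x : Tb k c) : Phi hc 0 x = x := by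
  rw [Phi, Bmap_zero, Bmap_zero, Bmap_zero, Fmap_zero hc]

include hk in
/-- `Phi` preserves membership in every plumbing domain. [folklore] -/
theorem Phi_mem_dom_iff (t : I) (j : Fin 3) (x : Tb k c) :
    (Phi hc t x : (𝕊 k) × (𝕊 k)) ∈ dom k c j ↔ (x : (𝕊 k) × (𝕊 k)) ∈ dom k c j := by
  rw [Phi, Fmap_mem_dom_iff, Bmap_mem_dom_iff hc hk, Bmap_mem_dom_iff hc hk, Bmap_mem_dom_iff hc hk]

include hk in
/-- On `D_j`, only the base shrink of colour `j` acts: `Φ_t = F_t ∘ B_j`. [folklore] -/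
theorem Phi_of_mem (t : I) {j : Fin 3} {x : Tb k c} (hx : (x : (𝕊 k) × (𝕊 k)) ∈ dom k c j) :
    Phi hc t x = Fmap t (Bmap hc j t x) := by
  have hoff : ∀ {j' : Fin 3}, j' ≠ j → ∀ {y : Tb k c}, (y : (𝕊 k) × (𝕊 k)) ∈ dom k c j → Bmap hc j' t y = y :=
    fun hj' y hy => Bmap_of_not_mem hc t fun h => dom_disjoint hk hc hj' h hy
  rw [Phi]
  fin_cases j
  · show Fmap t (Bmap hc 0 t (Bmap hc 1 t (Bmap hc 2 t x))) = Fmap t (Bmap hc 0 t x)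
    have e2 : Bmap hc 2 t x = x := hoff (by decide) hx
    have e1 : Bmap hc 1 t x = x := hoff (by decide) hx
    rw [e2, e1]
  · show Fmap t (Bmap hc 0 t (Bmap hc 1 t (Bmap hc 2 t x))) = Fmap t (Bmap hc 1 t x)
    have e2 : Bmap hc 2 t x = x := hoff (by decide) hx
    have hB := Bmap_mem_dom hc t hx
    have e0 : Bmap hc 0 t (Bmap hc 1 t x) = Bmap hc 1 t x := hoff (by decide) hB
    rw [e2, e0]
  · show Fmap t (Bmap hc 0 t (Bmap hc 1 t (Bmap hc 2 t x))) = Fmap t (Bmap hc 2 t x)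
    have hB := Bmap_mem_dom hc t hx
    have e1 : Bmap hc 1 t (Bmap hc 2 t x) = Bmap hc 2 t x := hoff (by decide) hB
    have e0 : Bmap hc 0 t (Bmap hc 2 t x) = Bmap hc 2 t x := hoff (by decide) hB
    rw [e1, e0]

/-- Off all plumbing domains, `Φ_t = F_t`. [folklore] -/
theorem Phi_of_forall_not_mem (t : I) {x : Tb k c} (hx : ∀ j, (x : (𝕊 k) × (𝕊 k)) ∉ dom k c j) :
    Phi hc t x = Fmap t x := by
  rw [Phi, Bmap_of_not_mem hc t (hx 2), Bmap_of_not_mem hc t (hx 1), Bmap_of_not_mem hc t (hx 0)]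

include hk in
/-- **`Phi` in the polar chart of `D_j`**: `(x, y) ↦ (g_t x, g_t y)`. [folklore] -/
theorem kap_Phi (t : I) {j : Fin 3} {x : Tb k c} (hx : (x : (𝕊 k) × (𝕊 k)) ∈ dom k c j) :
    kap (pole k j.val) (Phi hc t x : (𝕊 k) × (𝕊 k)) =
      (gPolar c t (kap (pole k j.val) (x : (𝕊 k) × (𝕊 k))).1, gPolar c t (kap (pole k j.val) (x : (𝕊 k) × (𝕊 k))).2) := by
  have hB := Bmap_mem_dom hc t hx
  rw [Phi_of_mem hk hc t hx, kap_Fmap _ t (by linarith [hB.1, hc.nonneg]), kap_Bmap hc t hx]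

/-- The polar chart is injective on the plumbing domain. [folklore] -/
theorem kap_injOn (hc : IsParam c) (j : Fin 3) : InjOn (kap (pole k j.val)) (dom k c j) := by
  intro x hx y hy h
  rw [← unkap_kap (pole k j.val) hc.nonneg hx, ← unkap_kap (pole k j.val) hc.nonneg hy]
  congr 1
  exact Subtype.ext h

include hk in
/-- **`Phi` commutes with the plumbing maps**: `pm_j (Φ_t x) = Φ_t (pm_j x)` on `D_j` (both have
polar coordinates `(g_t y, g_t x)`). [cite: Kosinski1993, VI.12 p. 120] -/
theorem pm_Phi (t : I) {j : Fin 3} {x : Tb k c} (hx : (x : (𝕊 k) × (𝕊 k)) ∈ dom k c j) :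
    pm hc j (Phi hc t x) = Phi hc t (pm hc j x) := by
  have hΦ : (Phi hc t x : (𝕊 k) × (𝕊 k)) ∈ dom k c j := (Phi_mem_dom_iff hk hc t j x).2 hx
  have hpm := pm_mem_dom hc hx
  have hΦ' : (Phi hc t (pm hc j x) : (𝕊 k) × (𝕊 k)) ∈ dom k c j := (Phi_mem_dom_iff hk hc t j _).2 hpm
  apply Subtype.ext
  refine kap_injOn hc j (pm_mem_dom hc hΦ) hΦ' ?_
  rw [coe_pm_of_mem hc hΦ, kap_plumbMap, kap_Phi hk hc t hx, kap_Phi hk hc t hpm, coe_pm_of_mem hc hx, kap_plumbMap]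
  rfl

/-- **A point of the tube whose polar fibre coordinate vanishes is on the diagonal.** [folklore] -/
theorem eq_of_kapSnd_eq_zero (hc : 0 ≤ c) (e : 𝕊 k) {x : Tb k c} (h : -1 < baseHt e (x : (𝕊 k) × (𝕊 k)))
    (h0 : kapSnd e (x : (𝕊 k) × (𝕊 k)) = 0) : (x : (𝕊 k) × (𝕊 k)).2 = (x : (𝕊 k) × (𝕊 k)).1 := by
  set p : 𝔼 (k + 1) := ((x : (𝕊 k) × (𝕊 k)).1 : 𝔼 (k + 1)) with hp
  set q : 𝔼 (k + 1) := ((x : (𝕊 k) × (𝕊 k)).2 : 𝔼 (k + 1)) with hq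
  have he := norm_eq_of_mem_sphere e
  have hpe : ‖p‖ = ‖(e : 𝔼 (k + 1))‖ := by rw [hp, norm_eq_of_mem_sphere, he]
  have hb : -1 < ⟪p, (e : 𝔼 (k + 1))⟫ := by rwa [baseHt_apply] at h
  have h0' : p + (e : 𝔼 (k + 1)) ≠ 0 := add_ne_zero_of_neg_one_lt_inner he hb
  -- `rotTo p e q = ⟪p, q⟫ e`
  have hw : rotTo p e q = fibHt (x : (𝕊 k) × (𝕊 k)) • (e : 𝔼 (k + 1)) := by
    have h1 := perp_add_smul (e : 𝔼 (k + 1)) (rotTo p e q)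
    change perp (e : 𝔼 (k + 1)) (rotTo p e q) = 0 at h0
    rw [h0, zero_add] at h1
    rw [← h1]
    congr 1
    have := inner_plumbFst_pole e (pq := (x : (𝕊 k) × (𝕊 k))) hb
    rw [coe_plumbFst] at this
    rw [this, fibHt_apply]
  -- so `q = ⟪p, q⟫ p`, and `⟪p, q⟫ = 1`
  have hq' : q = fibHt (x : (𝕊 k) × (𝕊 k)) • p := by
    have := congrArg (rotFrom p (e : 𝔼 (k + 1))) hw
    rw [rotFrom_rotTo, rotFrom_smul, rotFrom_pole hpe h0'] at this
    exact this
  have hf : fibHt (x : (𝕊 k) × (𝕊 k)) = 1 := by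
    have hn : ‖q‖ = |fibHt (x : (𝕊 k) × (𝕊 k))| := by
      rw [hq', norm_smul, Real.norm_eq_abs, hp, norm_eq_of_mem_sphere, mul_one]
    rw [hq, norm_eq_of_mem_sphere] at hn
    have hpos : 0 < fibHt (x : (𝕊 k) × (𝕊 k)) := hc.trans_lt (lt_fibHt_coe x)
    rw [abs_of_pos hpos] at hn
    exact hn.symm
  apply Subtype.ext
  change q = p
  rw [hq', hf, one_smul]

end Phi

/-! ### §6 The deformation `Θₜ` of the plumbed manifold -/

section Theta

variable {n : ℕ} (hk : 2 ≤ k) (hc : IsParam c) (hkn : k + k = n + 1)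

/-- **The deformation of the plumbed manifold**, `Θₜ = desc (ιᵥ ∘ Φₜ)`. [cite: Kosinski1993, VI.12 p. 122] -/
def Theta (t : I) : PV k c hk hc hkn → PV k c hk hc hkn :=
  desc hk hc hkn (fun v x => ι hk hc hkn v (Phi hc t x)) (by
    intro v w x hvw hx
    rw [← pm_Phi hk hc t hx]
    exact (ι_pm hk hc hkn v w hvw ((Phi_mem_dom_iff hk hc t _ x).2 hx)).symm)

/-- `Theta_ι` (Theta ι). [folklore] -/
@[simp] theorem Theta_ι (t : I) (v : Fin 8) (x : Tb k c) :
    Theta hk hc hkn t (ι hk hc hkn v x) = ι hk hc hkn v (Phi hc t x) := by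
  rw [Theta, desc_ι]

/-- **`Θ₀ = id`.** [folklore] -/
theorem Theta_zero (p : PV k c hk hc hkn) : Theta hk hc hkn 0 p = p := by
  obtain ⟨v, x, rfl⟩ := exists_ι_eq hk hc hkn p
  rw [Theta_ι, Phi_zero]

/-- **Joint continuity of `(t, p) ↦ Θₜ(p)`** (locally, through the tube embeddings). [folklore] -/
theorem continuous_Theta : Continuous fun q : I × PV k c hk hc hkn => Theta hk hc hkn q.1 q.2 := by
  rw [continuous_iff_continuousAt]
  rintro ⟨t₀, p₀⟩
  obtain ⟨v, x₀, rfl⟩ := exists_ι_eq hk hc hkn p₀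
  haveI := nonempty_Tb (k := k) hc.lt_one
  -- the local inverse of the tube embedding
  let e := (isOpenEmbedding_ι hk hc hkn v).toOpenPartialHomeomorph
  have hsymm : ContinuousAt e.symm (ι hk hc hkn v x₀) :=
    e.continuousAt_symm (e.map_source (mem_univ x₀))
  have h2 : ContinuousAt (fun q : I × PV k c hk hc hkn => (q.1, e.symm q.2)) (t₀, ι hk hc hkn v x₀) :=
    continuousAt_fst.prodMk
      (ContinuousAt.comp (f := fun q : I × PV k c hk hc hkn => q.2) (x := (t₀, ι hk hc hkn v x₀)) hsymm continuousAt_snd)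
  have h1 : ContinuousAt (fun q : I × PV k c hk hc hkn => ι hk hc hkn v (Phi hc q.1 (e.symm q.2))) (t₀, ι hk hc hkn v x₀) :=
    ContinuousAt.comp (f := fun q : I × PV k c hk hc hkn => (q.1, e.symm q.2)) (x := (t₀, ι hk hc hkn v x₀))
      ((continuous_ι hk hc hkn v).comp (continuous_Phi hc)).continuousAt h2
  refine h1.congr ?_
  have hopen : IsOpen {q : I × PV k c hk hc hkn | q.2 ∈ range (ι hk hc hkn v)} :=
    (isOpen_range_ι hk hc hkn v).preimage continuous_snd
  filter_upwards [hopen.mem_nhds (mem_range_self x₀)] with q hq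
  obtain ⟨y, hy⟩ : ∃ y, ι hk hc hkn v y = q.2 := hq
  have hleft : e.symm (ι hk hc hkn v y) = y := e.left_inv (mem_univ y)
  change ι hk hc hkn v (Phi hc q.1 (e.symm q.2)) = Theta hk hc hkn q.1 q.2
  rw [← hy, hleft, Theta_ι]

/-- The bound `min(a, b) ≤ G(a, b) + r²/4` in a plumbing square (`s = 1/4`). [folklore] -/
theorem min_le_cornerFn_add {a b : ℝ} (ha : 0 ≤ a) (hb : 0 ≤ b) (hab : a + b < 2 * rsq c) :
    min a b ≤ cornerFn (rsq c) bandSlope (a, b) + rsq c / 4 := by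
  have h := min_sub_le_cornerFn bandSlope_pos (r2 := rsq c) (p := (a, b)) hab
  simp only [bandW, bandSlope] at h ⊢
  have : (1 / 4 : ℝ) * (2 * rsq c - a - b) / 2 ≤ rsq c / 4 := by nlinarith
  linarith

/-- **`Θ₁` maps `{ρ ≤ r²/8}` into the core spheres**: for `ρ̂ᵥ(x) ≤ r²/8`, `Θ₁(ιᵥ x) = ι_w(p, p)`
for some vertex `w` and point `p`. [cite: Kosinski1993, VI.12 p. 122] -/
theorem exists_Theta_one_eq (v : Fin 8) (x : Tb k c) (hρ : rhoHat k c v (x : (𝕊 k) × (𝕊 k)) ≤ rsq c / 8) :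
    ∃ (w : Fin 8) (p : 𝕊 k), Theta hk hc hkn 1 (ι hk hc hkn v x) = ι hk hc hkn w (diagPt hc.lt_one p) := by
  rw [Theta_ι]
  have hR := rsq_pos hc
  -- the generic "fibre collapsed" conclusion
  have fibre_case : ∀ {y : Tb k c}, bFn (y : (𝕊 k) × (𝕊 k)) ≤ 3 * rsq c / 4 → ∀ (z : Tb k c), z = Fmap 1 y →
      ∃ p : 𝕊 k, z = diagPt hc.lt_one p := by
    intro y hb z hz
    refine ⟨((y : (𝕊 k) × (𝕊 k))).1, ?_⟩
    subst hz
    apply Subtype.ext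
    rw [Fmap, coe_diagPt]
    have : tI c 1 y = 1 := Subtype.ext (by simp [tI, amtOf_eq_one hc hb])
    rw [this]
    exact coe_fshrink_one y
  by_cases hdom : ∃ j, (x : (𝕊 k) × (𝕊 k)) ∈ dom k c j
  · obtain ⟨j, hx⟩ := hdom
    have hb1 : -1 < baseHt (pole k j.val) (x : (𝕊 k) × (𝕊 k)) := by linarith [hx.1, hc.nonneg]
    -- `min(a, b) ≤ 3r²/8` (active square) or `b ≤ r²/8` (inactive domain)
    have hsmall : aFn (pole k j.val) (x : (𝕊 k) × (𝕊 k)) ≤ 3 * rsq c / 4 ∨ bFn (x : (𝕊 k) × (𝕊 k)) ≤ 3 * rsq c / 4 := by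
      by_cases hact : ∃ w, kosinskiGamma8 v w = 1 ∧ ecol v w = j
      · obtain ⟨w, hvw, hcol⟩ := hact
        subst hcol
        rw [rhoHat_eq_cornerFn hk hc hvw hx] at hρ
        have hab := aFn_add_bFn_lt hc hx
        have hmin := min_le_cornerFn_add (c := c) (aFn_nonneg _ _) (bFn_nonneg _) hab
        rcases le_total (aFn (pole k (ecol v w).val) (x : (𝕊 k) × (𝕊 k))) (bFn (x : (𝕊 k) × (𝕊 k))) with h | h
        · left; rw [min_eq_left h] at hmin; linarith
        · right; rw [min_eq_right h] at hmin; linarith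
      · right
        push Not at hact
        have hoff : ∀ w, kosinskiGamma8 v w = 1 → (x : (𝕊 k) × (𝕊 k)) ∉ dom k c (ecol v w) :=
          fun w hvw h => dom_disjoint hk hc (hact w hvw) h hx
        rw [rhoHat_eq_bFn v hoff] at hρ
        linarith
    have hΦ : (Phi hc 1 x : (𝕊 k) × (𝕊 k)) ∈ dom k c j := (Phi_mem_dom_iff hk hc 1 j x).2 hx
    have hkap := kap_Phi hk hc 1 hx
    -- the fibre collapses whenever `b ≤ 3r²/4`: `Φ₁ x` is on the diagonal of the tube `v`
    have fibre_collapse : bFn (x : (𝕊 k) × (𝕊 k)) ≤ 3 * rsq c / 4 →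
        ∃ (w : Fin 8) (p : 𝕊 k), ι hk hc hkn v (Phi hc 1 x) = ι hk hc hkn w (diagPt hc.lt_one p) := by
      intro hb
      have h0 : kapSnd (pole k j.val) (Phi hc 1 x : (𝕊 k) × (𝕊 k)) = 0 := by
        have := congrArg Prod.snd hkap
        simp only [kap_snd] at this
        rw [this, gPolar, norm_kapSnd_sq _ hb1, ← bFn_apply]
        simp [amtOf_eq_one hc hb]
      have hdiag := eq_of_kapSnd_eq_zero hc.nonneg (pole k j.val) (by linarith [hΦ.1, hc.nonneg]) h0
      refine ⟨v, ((Phi hc 1 x : (𝕊 k) × (𝕊 k))).1, ?_⟩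
      congr 1
      apply Subtype.ext
      rw [coe_diagPt]
      exact Prod.ext rfl hdiag
    by_cases hb : bFn (x : (𝕊 k) × (𝕊 k)) ≤ 3 * rsq c / 4
    · exact fibre_collapse hb
    have ha : aFn (pole k j.val) (x : (𝕊 k) × (𝕊 k)) ≤ 3 * rsq c / 4 := hsmall.resolve_right hb
    -- the base collapses; the colour `j` is active (otherwise `b ≤ r²/8`)
    have hact : ∃ w, kosinskiGamma8 v w = 1 ∧ ecol v w = j := by
      by_contra hact
      push Not at hact
      have hoff : ∀ w, kosinskiGamma8 v w = 1 → (x : (𝕊 k) × (𝕊 k)) ∉ dom k c (ecol v w) :=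
        fun w hvw h => dom_disjoint hk hc (hact w hvw) h hx
      rw [rhoHat_eq_bFn v hoff] at hρ
      exact hb (by linarith)
    obtain ⟨w, hvw, hcol⟩ := hact
    subst hcol
    set y := pm hc (ecol v w) (Phi hc 1 x) with hy
    have hymem : (y : (𝕊 k) × (𝕊 k)) ∈ dom k c (ecol v w) := pm_mem_dom hc hΦ
    have h0 : kapSnd (pole k (ecol v w).val) (y : (𝕊 k) × (𝕊 k)) = 0 := by
      have h1 : kap (pole k (ecol v w).val) (y : (𝕊 k) × (𝕊 k)) = (kap (pole k (ecol v w).val) (Phi hc 1 x : (𝕊 k) × (𝕊 k))).swap := by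
        rw [hy, coe_pm_of_mem hc hΦ, kap_plumbMap]
      have := congrArg Prod.snd h1
      simp only [kap_snd, Prod.snd_swap] at this
      rw [this, hkap]
      simp only
      rw [gPolar, kap_fst, norm_kapFst_sq, ← aFn_apply]
      simp [amtOf_eq_one hc ha]
    have hdiag := eq_of_kapSnd_eq_zero hc.nonneg (pole k (ecol v w).val) (by linarith [hymem.1, hc.nonneg]) h0
    refine ⟨w, ((y : (𝕊 k) × (𝕊 k))).1, ?_⟩
    rw [← ι_pm hk hc hkn v w hvw hΦ, ← hy]
    congr 1
    apply Subtype.ext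
    rw [coe_diagPt]
    exact Prod.ext rfl hdiag
  · -- off all plumbing domains: `Φ₁ = F₁`, and `ρ̂ = b ≤ r²/8`
    push Not at hdom
    have hoff : ∀ w, kosinskiGamma8 v w = 1 → (x : (𝕊 k) × (𝕊 k)) ∉ dom k c (ecol v w) := fun w _ => hdom _
    rw [rhoHat_eq_bFn v hoff] at hρ
    obtain ⟨p, hp⟩ := fibre_case (y := x) (by linarith) (Phi hc 1 x) (Phi_of_forall_not_mem hc 1 hdom)
    exact ⟨v, p, by rw [hp]⟩

end Theta

end Plumbing

end Literature.Topology.FourManifolds
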